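import Summits.ResolutionOfSingularities.ResolutionOfSingularities.Theorems.FrobeniusClosingPatchingRelPerfectCoreRungTower
import HarnessLib

/-!
# Crux `PatchingRelPerfect` (stmt-ResolutionOfSingularities-16161), chain w52 — CORE RUNG r1τ,
# part 3: the WEAK-TRANSFORM TOWER `𝔞 + 𝔪^{d+e+1}` under chartwise regular weak transforms

[OURS · L1 W5.2 · rung r1τ] The regular-centre tower of `…CoreRungTowerCharts.lean` consumes
exactly "a quasi-regular sequence with regular quotient in a regular ring".  After ONE point
blow-up this is the situation of every ideal `K = 𝔞 + 𝔪^{d+e+1}`, `𝔞 = (q₁, …, q_c)`, whose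
generators have, on each Rees chart `B_i = (S[𝔪t])_{(x_i t)}`, WEAK TRANSFORMS
`q̃_{i,l} = q_l / x_iᵈ` such that the chart family `(x_i, q̃_{i,1}, …, q̃_{i,c})` is weakly regular
with `B_i/(x_i, q̃_i)` a regular ring — i.e. the initial forms of the `q_l` (all of degree `d`)
cut a regular complete intersection `Z ⊆ E ≅ ℙ^{n-1}_κ` chart by chart (stub-3 NOTE
2026-08-26T23:44Z (2): "`(q) + (x_iᵖ)`, `ord q = d < p`, `V(q̄)` regular ⇒ FOUND via the tower of
`p − d` blow-ups in the codim-2 regular centres"; CORE-MECHANISM-NOTE §1).  This file proves that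
mechanism for every `e`, every `c`, every regular local `S` of every dimension, with the chart
condition kept ABSTRACT (hypotheses `hqt`, `hreg`, `hquot` on given elements `q̃_{i,l} ∈ B_i`);
discharging it from "dehomogenised initial forms regular" is the chart API of rung r1t (stub-4)
and is not done here.  PROVED:

* `CoreRungTower.map_chartBase_sup_pow_weakTransform`, `…_prod_weakTransform` — on `B_i`,
  `(𝔞 + 𝔪^{d+k+1}) B_i = (x_iᵈ) · ((q̃_i) + (x_i^{k+1}))`, and the tail of the tower accordingly;
* `isRegular_of_isBlowup_weakTransform_tower` — every blowing up of `Spec S` along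
  `𝔪 · ∏_{k<e} (𝔞 + 𝔪^{d+k+1})` is regular (`Bl_𝔪`, then the ring-level tower
  `isRegular_of_isBlowup_tower` for the chart family `(x_i, q̃_i)` on every chart);
* `companion_span_sup_pow_weakTransform` — `𝔞 + 𝔪^{d+e+1}` is in the companion class `𝒞`
  (companion `𝔪 · ∏_{k<e} (𝔞 + 𝔪^{d+k+1}) ⊇ 𝔪^{1+e(d+e)}`), `coreRung_span_sup_pow_weakTransform` —
  the blow-up-form core's conclusion for every `T = Bl_{𝔞 + 𝔪^{d+e+1}} Spec S`;
* `companion_frobeniusMember_weakTransform`, `coreRung_frobeniusMember_weakTransform` — the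
  K5.2b-hunt shape `I = 𝔞 + (x₁ᵃ, …, x_nᵃ)`, `a = d + e + 1` (a sup-reduction of `𝔞 + 𝔪ᵃ` by
  r1a's pigeonhole, stub-2's `companion_sup_of_reduction`): e.g. `(q) + (x₁ᵖ, …, x₄ᵖ)` with
  `ord q = d < p` and chartwise regular weak transform, for EVERY `p − d ≥ 1`.

FORMAT evidence for the core (CHAIN §1 (A)); the located wild kernel (thickenings with SINGULAR
initial form, CHAIN v1.2 §4) is exactly where `hquot` fails.  Nothing here is a statement of the
manuscript under review.

## References

* Q. Liu, *Algebraic Geometry and Arithmetic Curves*, OUP 2002, Thm. 8.1.19 (a). [Liu2002]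
* The Stacks Project, Tags 080A, 080B, 0804, 0BIQ. [StacksProject]
-/

-- `Summit.<Summit>.<Sub>.Theorems` with `Sub = Summit` (single-conjunct summit, D-0017)
set_option linter.dupNamespace false

noncomputable section

open CategoryTheory CategoryTheory.Limits AlgebraicGeometry Literature.AlgebraicGeometry.Resolution
open Summit.ResolutionOfSingularities.ResolutionOfSingularities.Theorems.CoreRungTower

namespace Summit.ResolutionOfSingularities.ResolutionOfSingularities.Theorems

universe u

/-! ## Chart images under weak-transform data (any ring) -/

section ChartImages

variable {S : Type u} [CommRing S] {n c : ℕ} (x : Fin n → S) (q : Fin c → S) (d : ℕ)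
  (i : Fin n) (qt : Fin c → chartRing x i)
  (hqt : ∀ l, chartBase x i (q l) = chartBase x i (x i) ^ d * qt l)

include hqt in
/-- **The ideal `𝔞 = (q)` on a chart with weak transforms**: `𝔞 · B_i = (x_iᵈ) · (q̃_{i,1}, …)`.
[cite: StacksProject, Tag 0804] -/
theorem CoreRungTower.map_chartBase_span_weakTransform :
    (Ideal.span (Set.range q)).map (chartBase x i) =
      Ideal.span {chartBase x i (x i) ^ d} * Ideal.span (Set.range qt) := by
  apply le_antisymm
  · rw [Ideal.map_span, Ideal.span_le]
    rintro _ ⟨_, ⟨l, rfl⟩, rfl⟩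
    rw [SetLike.mem_coe, hqt l]
    exact Ideal.mul_mem_mul (Ideal.mem_span_singleton_self _) (Ideal.subset_span ⟨l, rfl⟩)
  · rw [Ideal.span_mul_span', Ideal.span_le]
    rintro _ ⟨b, hb, s, hs, rfl⟩
    rw [Set.mem_singleton_iff] at hb
    subst hb
    obtain ⟨l, rfl⟩ := hs
    show chartBase x i (x i) ^ d * qt l ∈ _
    rw [← hqt l]
    exact Ideal.mem_map_of_mem _ (Ideal.subset_span ⟨l, rfl⟩)

include hqt in
/-- **A tower factor on a chart**: `(𝔞 + M^{d+k+1}) · B_i = (x_iᵈ) · ((q̃_i) + (x_i^{k+1}))`,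
`M = (x)`. [cite: StacksProject, Tag 0804] -/
theorem CoreRungTower.map_chartBase_sup_pow_weakTransform (k : ℕ) :
    (Ideal.span (Set.range q) ⊔ Ideal.span (Set.range x) ^ (d + k + 1)).map (chartBase x i) =
      Ideal.span {chartBase x i (x i) ^ d} *
        (Ideal.span (Set.range qt) ⊔ Ideal.span {chartBase x i (x i) ^ (k + 1)}) := by
  rw [Ideal.map_sup, CoreRungTower.map_chartBase_span_weakTransform x q d i qt hqt, Ideal.map_pow,
    map_reesChartBase_eq (x i) (Ideal.mem_span_range_self (f := x) (x := i)),
    Ideal.span_singleton_pow, add_assoc, pow_add, ← Ideal.span_singleton_mul_span_singleton,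
    ← Ideal.mul_sup]

include hqt in
/-- **The tail of the tower on a chart**: `(∏_{k<e} (𝔞 + M^{d+k+1})) · B_i =
((x_iᵈ)ᵉ) · ∏_{k<e} ((q̃_i) + (x_i^{k+1}))`. [cite: StacksProject, Tag 0804] -/
theorem CoreRungTower.map_chartBase_prod_weakTransform (e : ℕ) :
    (∏ k ∈ Finset.range e,
      (Ideal.span (Set.range q) ⊔ Ideal.span (Set.range x) ^ (d + k + 1))).map (chartBase x i) =
      Ideal.span {(chartBase x i (x i) ^ d) ^ e} *
        ∏ k ∈ Finset.range e, (Ideal.span (Set.range qt) ⊔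
          Ideal.span {chartBase x i (x i) ^ (k + 1)}) := by
  rw [map_prod_range]
  simp_rw [CoreRungTower.map_chartBase_sup_pow_weakTransform x q d i qt hqt]
  rw [Finset.prod_mul_distrib, Finset.prod_const, Finset.card_range, Ideal.span_singleton_pow]

end ChartImages

/-! ## The weak-transform tower over a regular local ring -/

section LocalRung

variable {S : Type u} [CommRing S] [IsRegularLocalRing S] {n : ℕ} (x : Fin n → S)
  (hx : Ideal.span (Set.range x) = IsLocalRing.maximalIdeal S)
  (hd : (IsLocalRing.maximalIdeal S).spanFinrank = n)
  {c : ℕ} (q : Fin c → S) (d : ℕ) (qt : ∀ i : Fin n, Fin c → chartRing x i)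
  (hqt : ∀ i l, chartBase x i (q l) = chartBase x i (x i) ^ d * qt i l)
  (hreg : ∀ i, RingTheory.Sequence.IsWeaklyRegular (chartRing x i)
    (List.ofFn (Fin.cons (chartBase x i (x i)) (qt i))))
  (hquot : ∀ i, IsRegularRing (chartRing x i ⧸
    Ideal.span (Set.range (Fin.cons (chartBase x i (x i)) (qt i)))))

local notation3 "𝔞" => Ideal.span (Set.range q)

include hx hd hqt hreg hquot in
/-- **The weak-transform tower.** Let `S` be regular local with regular system of parameters
`x = (x₁, …, x_n)`, `𝔞 = (q₁, …, q_c)`, `d ≥ 0`, and suppose that on every Rees chart `B_i` of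
`Bl_𝔪 Spec S` there are weak transforms `q̃_{i,l}` (`q_l = x_iᵈ q̃_{i,l}` in `B_i`) such that
`(x_i, q̃_{i,1}, …, q̃_{i,c})` is a weakly regular sequence with `B_i/(x_i, q̃_i)` a regular ring.
Then for every `e`, every blowing up of `Spec S` along `𝔪 · ∏_{k<e} (𝔞 + 𝔪^{d+k+1})` is regular:
`Bl_𝔪` followed, chart by chart, by the regular-centre tower of the chart family.
[cite: Liu2002, Thm. 8.1.19 (a)] [cite: StacksProject, Tag 080A] -/
theorem isRegular_of_isBlowup_weakTransform_tower (e : ℕ) {Y : Scheme.{u}}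
    {f : Y ⟶ Spec (.of S)}
    (hf : IsBlowup f (affineBlowup.idealSheaf
      ((∏ k ∈ Finset.range e, (𝔞 ⊔ IsLocalRing.maximalIdeal S ^ (d + k + 1))) *
        IsLocalRing.maximalIdeal S))) :
    Scheme.IsRegular Y := by
  haveI : IsRegularRing S := isRegularRing_of_isRegularLocalRing S
  haveI : (Ideal.span (Set.range x)).IsMaximal := hx ▸ IsLocalRing.maximalIdeal.isMaximal S
  letI := Ideal.Quotient.field (Ideal.span (Set.range x))
  haveI : IsRegularRing (S ⧸ Ideal.span (Set.range x)) := inferInstance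
  have hxq := isQuasiRegular_regularSystemOfParameters hd x hx
  rw [← hx] at hf
  refine isRegular_of_isBlowup_mul_of_charts x _ (fun i Y' ρ hρ => ?_) hf
  haveI hB : IsRegularRing (chartRing x i) := isRegularRing_blowupChart x i hxq
  have hti : chartBase x i (x i) ∈ nonZeroDivisors (chartRing x i) :=
    reesChartBase_mem_nonZeroDivisors (x i) (Ideal.mem_span_range_self (f := x) (x := i))
  rw [CoreRungTower.map_chartBase_prod_weakTransform x q d i (qt i) (hqt i)] at hρ
  refine CoreRungTower.isRegular_of_isBlowup_span_singleton_mul (pow_mem (pow_mem hti d) e) _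
    (fun Y'' ρ' hρ' => ?_) hρ
  -- the tail is the ring-level tower for the chart family `x' = (x_i, q̃_i)`, `ι = Fin.succ`
  let x' : Fin (c + 1) → chartRing x i := Fin.cons (chartBase x i (x i)) (qt i)
  have hP' : Ideal.span (Set.range (x' ∘ Fin.succ)) = Ideal.span (Set.range (qt i)) := by
    congr 1
  have hM' : Ideal.span (Set.range x') =
      Ideal.span (Set.range (x' ∘ Fin.succ)) ⊔ Ideal.span {chartBase x i (x i)} := by
    rw [hP', show x' = Fin.cons (chartBase x i (x i)) (qt i) from rfl, Fin.range_cons,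
      Ideal.span_insert, sup_comm]
  have heq : ∏ k ∈ Finset.range e, (Ideal.span (Set.range (qt i)) ⊔
      Ideal.span {chartBase x i (x i) ^ (k + 1)}) =
      ∏ k ∈ Finset.range e, (Ideal.span (Set.range (x' ∘ Fin.succ)) ⊔
        Ideal.span (Set.range x') ^ (k + 1)) := by
    refine Finset.prod_congr rfl fun k _ => ?_
    rw [sup_pow_eq_sup_span_singleton_pow hM', hP']
  rw [heq] at hρ'
  exact isRegular_of_isBlowup_tower e x' Fin.succ (Fin.succ_injective c)
    (isQuasiRegular_of_isWeaklyRegular _ (hreg i)) (hquot i) hρ'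

include hx hd hqt hreg hquot in
/-- **`𝔞 + 𝔪^{d+e+1}` is in the companion class** under chartwise regular weak transforms:
companion `Q = 𝔪 · ∏_{k<e} (𝔞 + 𝔪^{d+k+1}) ⊇ 𝔪^{1 + e (d + e)}` with the weak-transform tower as
regular model (`e = 0`: companion `𝔪`, the tangent-cone case). [cite: Liu2002, Thm. 8.1.19 (a)]
[cite: StacksProject, Tag 080A] -/
theorem companion_span_sup_pow_weakTransform (e : ℕ) :
    ∃ (Q : Ideal S) (m' : ℕ), IsLocalRing.maximalIdeal S ^ m' ≤ Q ∧
      ∃ (B : Scheme.{u}) (b : B ⟶ Spec (.of S)),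
        IsBlowup b (affineBlowup.idealSheaf
          ((𝔞 ⊔ IsLocalRing.maximalIdeal S ^ (d + e + 1)) * Q)) ∧ Scheme.IsRegular B := by
  obtain ⟨B, b, hb⟩ := exists_isBlowup (Spec (.of S)) (affineBlowup.idealSheaf
    ((∏ k ∈ Finset.range (e + 1), (𝔞 ⊔ IsLocalRing.maximalIdeal S ^ (d + k + 1))) *
      IsLocalRing.maximalIdeal S))
  refine ⟨IsLocalRing.maximalIdeal S *
      ∏ k ∈ Finset.range e, (𝔞 ⊔ IsLocalRing.maximalIdeal S ^ (d + k + 1)),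
    1 + e * (d + e), ?_, B, b, ?_,
    isRegular_of_isBlowup_weakTransform_tower x hx hd q d qt hqt hreg hquot (e + 1) hb⟩
  · rw [pow_add, pow_one]
    exact Ideal.mul_mono_right (pow_mul_le_prod_range _ _ _ _ fun k hk =>
      le_sup_of_le_right (Ideal.pow_le_pow_right (by omega)))
  · have hsplit : (∏ k ∈ Finset.range (e + 1), (𝔞 ⊔ IsLocalRing.maximalIdeal S ^ (d + k + 1))) *
        IsLocalRing.maximalIdeal S =
        (𝔞 ⊔ IsLocalRing.maximalIdeal S ^ (d + e + 1)) * (IsLocalRing.maximalIdeal S *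
          ∏ k ∈ Finset.range e, (𝔞 ⊔ IsLocalRing.maximalIdeal S ^ (d + k + 1))) := by
      rw [Finset.prod_range_succ, mul_comm (IsLocalRing.maximalIdeal S), ← mul_assoc,
        mul_comm (∏ k ∈ Finset.range e, (𝔞 ⊔ IsLocalRing.maximalIdeal S ^ (d + k + 1)))]
    rwa [← hsplit]

include hx hd hqt hreg hquot in
/-- **CORE RUNG r1τ (weak-transform form).** Under the chartwise regular-weak-transform condition,
every blowing up `f : T ⟶ Spec S` along `K = 𝔞 + 𝔪^{d+e+1} ≠ 0` satisfies the conclusion of the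
blow-up-form open core `AtomDimFourBlowupAt` (companion `𝔪 · ∏_{k<e} (𝔞 + 𝔪^{d+k+1})`).  Every
dimension, every regular local base, every `e`. [cite: Liu2002, Thm. 8.1.19 (a)]
[cite: StacksProject, Tag 080A] -/
theorem coreRung_span_sup_pow_weakTransform (e : ℕ)
    (hI : 𝔞 ⊔ IsLocalRing.maximalIdeal S ^ (d + e + 1) ≠ ⊥) (T : Scheme.{u})
    (f : T ⟶ Spec (.of S))
    (hf : IsBlowup f (affineBlowup.idealSheaf (𝔞 ⊔ IsLocalRing.maximalIdeal S ^ (d + e + 1)))) :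
    ∃ (J : T.IdealSheafData) (T' : Scheme.{u}) (π : T' ⟶ T), J ≠ ⊥ ∧
      (∀ t : T, t ∈ J.support → f.base t = IsLocalRing.closedPoint S) ∧
      IsBlowup π J ∧ Scheme.IsRegular T' :=
  atomConclusion_of_companion' hI
    (companion_span_sup_pow_weakTransform x hx hd q d qt hqt hreg hquot e) T f hf

/-! ### The Frobenius-type members `𝔞 + (x₁ᵃ, …, x_nᵃ)`, `a = d + e + 1` -/

include hx hd hqt hreg hquot in
/-- **`𝔞 + (x₁ᵃ, …, x_nᵃ)`, `a = d + e + 1`, is in the companion class** under chartwise regular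
weak transforms: it is a sup-reduction of `𝔞 + 𝔪ᵃ` (`(x_jᵃ)_j · (𝔪ᵃ)ⁿ = (𝔪ᵃ)ⁿ⁺¹`, r1a's
pigeonhole), so stub-2's closure `companion_sup_of_reduction` applies; companion
`(𝔞 + 𝔪ᵃ)ⁿ · 𝔪 · ∏_{k<e} (𝔞 + 𝔪^{d+k+1})`.  The K5.2b-hunt shape `(q) + (x₁ᵖ, …, x₄ᵖ)`,
`ord q = d < p`, with regular initial hypersurface chart by chart, every `p − d ≥ 1`.
[cite: StacksProject, Tag 080A] -/
theorem companion_frobeniusMember_weakTransform (e : ℕ) :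
    ∃ (Q : Ideal S) (m' : ℕ), IsLocalRing.maximalIdeal S ^ m' ≤ Q ∧
      ∃ (B : Scheme.{u}) (b : B ⟶ Spec (.of S)),
        IsBlowup b (affineBlowup.idealSheaf
          ((𝔞 ⊔ Ideal.span (Set.range fun j => x j ^ (d + e + 1))) * Q)) ∧
        Scheme.IsRegular B := by
  have hle : Ideal.span (Set.range fun j => x j ^ (d + e + 1)) ≤
      IsLocalRing.maximalIdeal S ^ (d + e + 1) := by
    rw [Ideal.span_le]
    rintro _ ⟨j, rfl⟩
    exact Ideal.pow_mem_pow (hx ▸ Ideal.subset_span (Set.mem_range_self j)) _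
  have hlt : n * (d + e + 1 - 1) < (d + e + 1) + (d + e + 1) * n :=
    calc n * (d + e + 1 - 1) ≤ n * (d + e + 1) := Nat.mul_le_mul_left n (Nat.sub_le _ 1)
      _ = (d + e + 1) * n := mul_comm _ _
      _ < (d + e + 1) + (d + e + 1) * n := Nat.lt_add_of_pos_left (Nat.succ_pos _)
  have hred : Ideal.span (Set.range fun j => x j ^ (d + e + 1)) *
      (IsLocalRing.maximalIdeal S ^ (d + e + 1)) ^ n =
        (IsLocalRing.maximalIdeal S ^ (d + e + 1)) ^ (n + 1) := by
    rw [← pow_mul, ← pow_mul, show (d + e + 1) * (n + 1) = (d + e + 1) + (d + e + 1) * n by ring]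
    exact CoreRung.span_powers_mul_pow_eq_pow x hx hlt
  exact companion_sup_of_reduction hle hred le_sup_right
    (companion_span_sup_pow_weakTransform x hx hd q d qt hqt hreg hquot e)

include hx hd hqt hreg hquot in
/-- **CORE RUNG r1τ — Frobenius-type members.** Under the chartwise regular-weak-transform
condition on `𝔞 = (q₁, …, q_c)` (all `q_l = x_iᵈ q̃_{i,l}` on the charts), every blowing up
`f : T ⟶ Spec S` along `I = 𝔞 + (x₁ᵃ, …, x_nᵃ) ≠ 0`, `a = d + e + 1`, satisfies the conclusion of
the blow-up-form open core `AtomDimFourBlowupAt`.  Every dimension, every regular local base,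
every `e`. [cite: StacksProject, Tag 080A] [cite: Liu2002, Thm. 8.1.19 (a)] -/
theorem coreRung_frobeniusMember_weakTransform (e : ℕ)
    (hI : 𝔞 ⊔ Ideal.span (Set.range fun j => x j ^ (d + e + 1)) ≠ ⊥) (T : Scheme.{u})
    (f : T ⟶ Spec (.of S))
    (hf : IsBlowup f (affineBlowup.idealSheaf
      (𝔞 ⊔ Ideal.span (Set.range fun j => x j ^ (d + e + 1))))) :
    ∃ (J : T.IdealSheafData) (T' : Scheme.{u}) (π : T' ⟶ T), J ≠ ⊥ ∧
      (∀ t : T, t ∈ J.support → f.base t = IsLocalRing.closedPoint S) ∧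
      IsBlowup π J ∧ Scheme.IsRegular T' :=
  atomConclusion_of_companion' hI
    (companion_frobeniusMember_weakTransform x hx hd q d qt hqt hreg hquot e) T f hf

end LocalRung

end Summit.ResolutionOfSingularities.ResolutionOfSingularities.Theorems

end
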